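import Summits.Ventures.YMGap.FlowData.RectTubeCharacterLine
import HarnessLib

/-!
# Venture YMGap, track Y3 FLOW-DATA — the SIGNED `SU(2)` character Haar chain: links traversed backwards
# (`c ↦ c⁻¹`) integrate exactly like forward links (theorems only; tool for closed Wilson loops such as plaquette states)

HONEST FRAMING: venture file of the cell `pub-ymgap` (QuantumFields programme), track Y3; pure Haar bookkeeping on
`SU(2)`, companion of `RectTubeCharacterLine` (`su2_integral_prod_exp_mul_chebyshevU_chain`, forward links only).  A closed
contractible loop on the slice (e.g. a spatial plaquette `a_{x,μ} a_{x+ê_μ,ν} a_{x+ê_ν,μ}⁻¹ a_{x,ν}⁻¹`) traverses some links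
BACKWARDS; under `b ↦ c·b` such a link contributes `(c_e b_e)⁻¹ = b_e⁻¹ c_e⁻¹`, i.e. the integration variable enters as
`c_e⁻¹`.  Since `a₀(V⁻¹) = a₀(V)` and the Haar probability measure is inversion invariant, the one-step rule
`∫ e^{b a₀(V)} U_n(a₀(V^s Q)) dV = (c_n(b)/(n+1)) U_n(a₀(Q))` holds for `s = ±1` alike, and so does the whole chain.
No number, no row, nothing about limits or a mass gap.  Intended use (successor): the plaquette (glueball) witness for
the `e = 0` gap `m′ ≤ 4(−ln u(β)) + 2β#P + ln 2`.

* `continuous_ofFn_zpow_mul_prod` — continuity of `y ↦ ∏ₜ (yₜ^{sₜ} aₜ)`;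
* `su2_integral_exp_mul_chebyshevU_inv_mul` — `∫ e^{b a₀(V)} U_n(a₀(V⁻¹ Q)) dV = (c_n(b)/(n+1)) U_n(a₀(Q))`;
* `su2_integral_exp_mul_chebyshevU_zpow_mul` — the same with `V^s`, `s ∈ {1, −1}`;
* **`su2_integral_prod_exp_mul_chebyshevU_signedChain`** — `∫ ∏ₜ e^{b a₀(cₜ)} U_n(a₀(X ∏ₜ (cₜ^{sₜ} aₜ) Y)) dc
  = (c_n(b)/(n+1))^m U_n(a₀(X ∏ₜ aₜ Y))` for every sign vector `s ∈ {±1}^m`;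
* **`su2_integral_prod_exp_mul_chebyshevU_rectSignedLine`** — the slice version for an injective link family
  `ℓ : Fin m → links` (links off the family contribute `∫ e^{b a₀}` each);
* plaquette bookkeeping: `rectPlaquette_gauge` (conjugation by `γ x`), `rectPlaquette_fluxTwist` (blind to central twists),
  `zmod_one_ne_zero_of_two_le`, `rectTorusSite_single_one_ne_zero`, `rectPlaquetteLinks_injective` (four distinct links).

References: I. Montvay, G. Münster (1994) §3.2.6 [cite: MontvayMunster1994, §3.2.6]; G. Münster, Nucl. Phys. B 190 (1981)
439 (strong-coupling glueball mass `4|ln u|`) [folklore].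
-/

noncomputable section

open scoped BigOperators ENNReal
open MeasureTheory Filter Function Polynomial.Chebyshev
open Literature.MathematicalPhysics.QuantumFieldTheory Literature.Analysis.OperatorTheory Literature.Analysis.FunctionSpaces
open Literature.MathematicalPhysics.QuantumLattice (RectTorusSite)
open Summit.Ventures.LatticeQCDFlow.Exactness Summit.Ventures.LatticeQCDFlow.Scoring
open Literature.Barriers.QuantumFields

namespace Summit.Ventures.YMGap.FlowData

section SignedChain

/-- Continuity of `y ↦ ∏ₜ (yₜ^{sₜ} aₜ)` on `Gᵐ` for a topological group. [folklore] -/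
theorem continuous_ofFn_zpow_mul_prod {G : Type*} [Group G] [TopologicalSpace G] [IsTopologicalGroup G] :
    ∀ (m : ℕ) (s : Fin m → ℤ) (a : Fin m → G), Continuous fun y : Fin m → G => (List.ofFn fun t => y t ^ s t * a t).prod
  | 0, s, a => by simp only [List.ofFn_zero, List.prod_nil]; exact continuous_const
  | m + 1, s, a => by
    simp only [List.ofFn_succ, List.prod_cons]
    exact (((continuous_apply 0).zpow (s 0)).mul continuous_const).mul
      ((continuous_ofFn_zpow_mul_prod m (fun t => s t.succ) (fun t => a t.succ)).comp
        (continuous_pi fun i => continuous_apply _))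

/-- **One backward step**: `∫ e^{b a₀(V)} U_n(a₀(V⁻¹ Q)) dV = (c_n(b)/(n+1)) U_n(a₀(Q))` (`b ≥ 0`; inversion invariance of
the Haar probability measure and `a₀(V⁻¹) = a₀(V)`). [cite: MontvayMunster1994, §3.2.6] -/
theorem su2_integral_exp_mul_chebyshevU_inv_mul {b : ℝ} (hb : 0 ≤ b) (n : ℕ) (Q : Matrix.specialUnitaryGroup (Fin 2) ℂ) :
    ∫ V, Real.exp (b * su2a0 V) * (U ℝ n).eval (su2a0 (V⁻¹ * Q)) ∂haarProbability (Matrix.specialUnitaryGroup (Fin 2) ℂ) =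
      (besselI n b - besselI (n + 2) b) / (n + 1) * (U ℝ n).eval (su2a0 Q) := by
  rw [← integral_inv_eq_self (fun V : Matrix.specialUnitaryGroup (Fin 2) ℂ =>
    Real.exp (b * su2a0 V) * (U ℝ n).eval (su2a0 (V⁻¹ * Q))) (haarProbability (Matrix.specialUnitaryGroup (Fin 2) ℂ))]
  simp only [inv_inv, su2a0_inv]
  exact su2_integral_exp_mul_chebyshevU_mul hb n Q

/-- **One signed step**: `∫ e^{b a₀(V)} U_n(a₀(V^s Q)) dV = (c_n(b)/(n+1)) U_n(a₀(Q))` for `s ∈ {1, −1}`.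
[cite: MontvayMunster1994, §3.2.6] -/
theorem su2_integral_exp_mul_chebyshevU_zpow_mul {b : ℝ} (hb : 0 ≤ b) (n : ℕ) {s : ℤ} (hs : s = 1 ∨ s = -1)
    (Q : Matrix.specialUnitaryGroup (Fin 2) ℂ) :
    ∫ V, Real.exp (b * su2a0 V) * (U ℝ n).eval (su2a0 (V ^ s * Q)) ∂haarProbability (Matrix.specialUnitaryGroup (Fin 2) ℂ) =
      (besselI n b - besselI (n + 2) b) / (n + 1) * (U ℝ n).eval (su2a0 Q) := by
  rcases hs with rfl | rfl
  · simp only [zpow_one]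
    exact su2_integral_exp_mul_chebyshevU_mul hb n Q
  · simp only [zpow_neg, zpow_one]
    exact su2_integral_exp_mul_chebyshevU_inv_mul hb n Q

/-- **The SIGNED `SU(2)` character Haar chain**: for `m` independent Haar link variables `c₀, …, c_{m−1}` weighted by
`e^{b a₀}` (`b ≥ 0`), signs `sₜ ∈ {1, −1}` and fixed `X, Y, a₀, …, a_{m−1}`,
`∫ ∏ₜ e^{b a₀(cₜ)} U_n(a₀(X c₀^{s₀}a₀ ⋯ c_{m−1}^{s_{m−1}}a_{m−1} Y)) dc = (c_n(b)/(n+1))^m U_n(a₀(X a₀⋯a_{m−1} Y))`. [folklore] -/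
theorem su2_integral_prod_exp_mul_chebyshevU_signedChain {b : ℝ} (hb : 0 ≤ b) (n : ℕ) :
    ∀ (m : ℕ) (s : Fin m → ℤ) (_ : ∀ t, s t = 1 ∨ s t = -1) (a : Fin m → Matrix.specialUnitaryGroup (Fin 2) ℂ)
      (X Y : Matrix.specialUnitaryGroup (Fin 2) ℂ),
      ∫ y : Fin m → Matrix.specialUnitaryGroup (Fin 2) ℂ, (∏ t, Real.exp (b * su2a0 (y t))) *
          (U ℝ n).eval (su2a0 (X * (List.ofFn fun t => y t ^ s t * a t).prod * Y))
          ∂(Measure.pi fun _ => haarProbability (Matrix.specialUnitaryGroup (Fin 2) ℂ)) =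
        ((besselI n b - besselI (n + 2) b) / (n + 1)) ^ m * (U ℝ n).eval (su2a0 (X * (List.ofFn a).prod * Y))
  | 0, s, _, a, X, Y => by
    simp [List.ofFn_zero, measureReal_def]
  | m + 1, s, hs, a, X, Y => by
    set μ := haarProbability (Matrix.specialUnitaryGroup (Fin 2) ℂ) with hμ
    have e := measurePreserving_piFinSuccAbove (fun _ : Fin (m + 1) => μ) 0
    rw [← e.symm.integral_comp' (g := fun y : Fin (m + 1) → Matrix.specialUnitaryGroup (Fin 2) ℂ =>
      (∏ t, Real.exp (b * su2a0 (y t))) * (U ℝ n).eval (su2a0 (X * (List.ofFn fun t => y t ^ s t * a t).prod * Y)))]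
    have hsymm : ∀ x : Matrix.specialUnitaryGroup (Fin 2) ℂ × (Fin m → Matrix.specialUnitaryGroup (Fin 2) ℂ),
        (MeasurableEquiv.piFinSuccAbove (fun _ : Fin (m + 1) => Matrix.specialUnitaryGroup (Fin 2) ℂ) 0).symm x =
          Fin.cons x.1 x.2 := by
      intro x
      rw [MeasurableEquiv.piFinSuccAbove_symm_apply]
      simp [Fin.insertNthEquiv, Fin.insertNth_zero']
    have hG : ∀ x : Matrix.specialUnitaryGroup (Fin 2) ℂ × (Fin m → Matrix.specialUnitaryGroup (Fin 2) ℂ),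
        (fun y : Fin (m + 1) → Matrix.specialUnitaryGroup (Fin 2) ℂ =>
          (∏ t, Real.exp (b * su2a0 (y t))) * (U ℝ n).eval (su2a0 (X * (List.ofFn fun t => y t ^ s t * a t).prod * Y)))
          ((MeasurableEquiv.piFinSuccAbove (fun _ : Fin (m + 1) => Matrix.specialUnitaryGroup (Fin 2) ℂ) 0).symm x) =
        Real.exp (b * su2a0 x.1) * ((∏ t, Real.exp (b * su2a0 (x.2 t))) *
          (U ℝ n).eval (su2a0 ((X * x.1 ^ s 0 * a 0) * (List.ofFn fun t => x.2 t ^ s t.succ * a t.succ).prod * Y))) := by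
      intro x
      rw [hsymm]
      simp only [Fin.prod_univ_succ, Fin.cons_zero, Fin.cons_succ, List.ofFn_succ, List.prod_cons]
      simp only [mul_assoc]
    simp_rw [hG]
    have hFc : Continuous fun x : Matrix.specialUnitaryGroup (Fin 2) ℂ × (Fin m → Matrix.specialUnitaryGroup (Fin 2) ℂ) =>
        Real.exp (b * su2a0 x.1) * ((∏ t, Real.exp (b * su2a0 (x.2 t))) *
          (U ℝ n).eval (su2a0 ((X * x.1 ^ s 0 * a 0) * (List.ofFn fun t => x.2 t ^ s t.succ * a t.succ).prod * Y))) := by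
      have h1 : Continuous fun x : Matrix.specialUnitaryGroup (Fin 2) ℂ × (Fin m → Matrix.specialUnitaryGroup (Fin 2) ℂ) =>
          X * x.1 ^ s 0 * a 0 := (continuous_const.mul (continuous_fst.zpow (s 0))).mul continuous_const
      have h2 : Continuous fun x : Matrix.specialUnitaryGroup (Fin 2) ℂ × (Fin m → Matrix.specialUnitaryGroup (Fin 2) ℂ) =>
          (List.ofFn fun t => x.2 t ^ s t.succ * a t.succ).prod :=
        (continuous_ofFn_zpow_mul_prod m (fun t => s t.succ) (fun t => a t.succ)).comp continuous_snd
      exact (Real.continuous_exp.comp (continuous_const.mul (continuous_su2a0.comp continuous_fst))).mul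
        ((continuous_finsetProd _ fun t _ =>
          Real.continuous_exp.comp (continuous_const.mul (continuous_su2a0.comp ((continuous_apply t).comp continuous_snd)))).mul
          ((U ℝ n).continuous.comp (continuous_su2a0.comp ((h1.mul h2).mul continuous_const))))
    have hInt : Integrable (fun x : Matrix.specialUnitaryGroup (Fin 2) ℂ × (Fin m → Matrix.specialUnitaryGroup (Fin 2) ℂ) =>
        Real.exp (b * su2a0 x.1) * ((∏ t, Real.exp (b * su2a0 (x.2 t))) *
          (U ℝ n).eval (su2a0 ((X * x.1 ^ s 0 * a 0) * (List.ofFn fun t => x.2 t ^ s t.succ * a t.succ).prod * Y))))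
        (μ.prod (Measure.pi fun _ : Fin m => μ)) :=
      hFc.integrable_of_hasCompactSupport (HasCompactSupport.of_compactSpace _)
    rw [integral_prod _ hInt]
    have hinner : ∀ x : Matrix.specialUnitaryGroup (Fin 2) ℂ,
        ∫ y : Fin m → Matrix.specialUnitaryGroup (Fin 2) ℂ, Real.exp (b * su2a0 x) * ((∏ t, Real.exp (b * su2a0 (y t))) *
          (U ℝ n).eval (su2a0 ((X * x ^ s 0 * a 0) * (List.ofFn fun t => y t ^ s t.succ * a t.succ).prod * Y)))
          ∂(Measure.pi fun _ : Fin m => μ) =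
        Real.exp (b * su2a0 x) * (((besselI n b - besselI (n + 2) b) / (n + 1)) ^ m *
          (U ℝ n).eval (su2a0 ((X * x ^ s 0 * a 0) * (List.ofFn fun t => a t.succ).prod * Y))) := by
      intro x
      rw [integral_const_mul, su2_integral_prod_exp_mul_chebyshevU_signedChain hb n m (fun t => s t.succ)
        (fun t => hs t.succ) (fun t => a t.succ) (X * x ^ s 0 * a 0) Y]
    simp_rw [hinner]
    -- outer integral: cyclicity `a₀(X x^{s₀} Q) = a₀(x^{s₀} (Q X))` and the signed one-step rule
    have hout : ∀ x : Matrix.specialUnitaryGroup (Fin 2) ℂ,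
        Real.exp (b * su2a0 x) * (((besselI n b - besselI (n + 2) b) / (n + 1)) ^ m *
          (U ℝ n).eval (su2a0 ((X * x ^ s 0 * a 0) * (List.ofFn fun t => a t.succ).prod * Y))) =
        ((besselI n b - besselI (n + 2) b) / (n + 1)) ^ m * (Real.exp (b * su2a0 x) *
          (U ℝ n).eval (su2a0 (x ^ s 0 * ((a 0 * (List.ofFn fun t => a t.succ).prod * Y) * X)))) := by
      intro x
      have hcyc : su2a0 ((X * x ^ s 0 * a 0) * (List.ofFn fun t => a t.succ).prod * Y) =
          su2a0 (x ^ s 0 * ((a 0 * (List.ofFn fun t => a t.succ).prod * Y) * X)) := by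
        rw [show (X * x ^ s 0 * a 0) * (List.ofFn fun t => a t.succ).prod * Y =
          X * (x ^ s 0 * ((a 0 * (List.ofFn fun t => a t.succ).prod * Y))) by simp only [mul_assoc], su2a0_mul_comm]
        simp only [mul_assoc]
      rw [hcyc]
      ring
    simp_rw [hout]
    rw [integral_const_mul, su2_integral_exp_mul_chebyshevU_zpow_mul hb n (hs 0), List.ofFn_succ, List.prod_cons]
    have hcyc2 : su2a0 ((a 0 * (List.ofFn fun t => a t.succ).prod * Y) * X) =
        su2a0 (X * (a 0 * (List.ofFn fun i : Fin m => a i.succ).prod) * Y) := by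
      rw [su2a0_mul_comm]
      simp only [mul_assoc]
    rw [hcyc2, pow_succ]
    ring

variable {k : ℕ} {Ls : Fin k → ℕ} [∀ i, NeZero (Ls i)]

/-- **The signed character Haar chain on the rectangular slice**: for an injective `ℓ : Fin m → links`, signs
`sₜ ∈ {1, −1}` and `b ≥ 0`,
`∫ (∏_e e^{b a₀(c_e)}) U_n(a₀(∏ₜ c_{ℓ t}^{sₜ} aₜ)) dc = (∫ e^{b a₀})^{N−m} (c_n(b)/(n+1))^m U_n(a₀(∏ₜ aₜ))`. [folklore] -/
theorem su2_integral_prod_exp_mul_chebyshevU_rectSignedLine {b : ℝ} (hb : 0 ≤ b) (n : ℕ) {m : ℕ}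
    (ℓ : Fin m → RectTorusSite Ls × Fin k) (hℓ : Injective ℓ) {s : Fin m → ℤ} (hs : ∀ t, s t = 1 ∨ s t = -1)
    (a : Fin m → Matrix.specialUnitaryGroup (Fin 2) ℂ) :
    ∫ c, (∏ e : RectTorusSite Ls × Fin k, Real.exp (b * su2a0 (c e))) *
        (U ℝ n).eval (su2a0 ((List.ofFn fun t => c (ℓ t) ^ s t * a t).prod))
        ∂(rectSliceMeasure (Matrix.specialUnitaryGroup (Fin 2) ℂ) Ls) =
      (∫ g, Real.exp (b * su2a0 g) ∂haarProbability (Matrix.specialUnitaryGroup (Fin 2) ℂ)) ^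
          (Fintype.card (RectTorusSite Ls × Fin k) - m) *
        ((besselI n b - besselI (n + 2) b) / (n + 1)) ^ m * (U ℝ n).eval (su2a0 ((List.ofFn a).prod)) := by
  classical
  set S : Set (RectTorusSite Ls × Fin k) := Set.range ℓ with hS
  set e : Fin m ⊕ ↥Sᶜ ≃ RectTorusSite Ls × Fin k :=
    (Equiv.sumCongr (Equiv.ofInjective ℓ hℓ) (Equiv.refl _)).trans (Equiv.Set.sumCompl S) with he
  have he1 : ∀ t : Fin m, e (Sum.inl t) = ℓ t := fun t => by
    simp [he, Equiv.Set.sumCompl_apply_inl]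
  set f : (Fin m → Matrix.specialUnitaryGroup (Fin 2) ℂ) → ℝ :=
    fun y => (U ℝ n).eval (su2a0 ((List.ofFn fun t => y t ^ s t * a t).prod)) with hf
  have h1 : (fun c : RectSlice Ls (Matrix.specialUnitaryGroup (Fin 2) ℂ) =>
      (∏ e : RectTorusSite Ls × Fin k, Real.exp (b * su2a0 (c e))) *
        (U ℝ n).eval (su2a0 ((List.ofFn fun t => c (ℓ t) ^ s t * a t).prod))) =
      fun c => f (fun i => c (e (Sum.inl i))) *
        ∏ t : RectTorusSite Ls × Fin k, (fun _ : RectTorusSite Ls × Fin k => fun g => Real.exp (b * su2a0 g)) t (c t) := by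
    funext c
    simp only [hf, he1, mul_comm]
  rw [h1, slab_integral_pi_window_one (haarProbability (Matrix.specialUnitaryGroup (Fin 2) ℂ)) e
    (fun _ : RectTorusSite Ls × Fin k => fun g => Real.exp (b * su2a0 g)) f]
  have h2 : ∫ y : Fin m → Matrix.specialUnitaryGroup (Fin 2) ℂ,
      f y * ∏ i, (fun _ : RectTorusSite Ls × Fin k => fun g : Matrix.specialUnitaryGroup (Fin 2) ℂ =>
        Real.exp (b * su2a0 g)) (e (Sum.inl i)) (y i)
      ∂(Measure.pi fun _ => haarProbability (Matrix.specialUnitaryGroup (Fin 2) ℂ)) =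
      ((besselI n b - besselI (n + 2) b) / (n + 1)) ^ m * (U ℝ n).eval (su2a0 ((List.ofFn a).prod)) := by
    simp only [hf]
    simp_rw [mul_comm ((U ℝ n).eval _) (∏ i : Fin m, Real.exp _)]
    have h := su2_integral_prod_exp_mul_chebyshevU_signedChain hb n m s hs a 1 1
    simp only [one_mul, mul_one] at h
    exact h
  rw [h2, Finset.prod_const, Finset.card_univ]
  have hcard : Fintype.card ↥Sᶜ = Fintype.card (RectTorusSite Ls × Fin k) - m := by
    rw [Fintype.card_compl_set, Set.card_range_of_injective hℓ, Fintype.card_fin]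
  rw [hcard]
  ring

end SignedChain

/-! ### The plaquette holonomy: gauge covariance, twist invariance, distinct links -/

section Plaquette

variable {G : Type*} [Group G] {k : ℕ} {Ls : Fin k → ℕ} [∀ i, NeZero (Ls i)]

omit [∀ i, NeZero (Ls i)] in
/-- Under a gauge transformation the plaquette holonomy at `x` is conjugated by `γ x`. [folklore] -/
theorem rectPlaquette_gauge (γ : RectTorusSite Ls → G) (b : RectSlice Ls G) (x : RectTorusSite Ls) {μ ν : Fin k} :
    (fun e : RectTorusSite Ls × Fin k => γ e.1 * b e * (γ (e.1 + Pi.single e.2 1))⁻¹) (x, μ) *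
        (fun e : RectTorusSite Ls × Fin k => γ e.1 * b e * (γ (e.1 + Pi.single e.2 1))⁻¹) (x + Pi.single μ 1, ν) *
        ((fun e : RectTorusSite Ls × Fin k => γ e.1 * b e * (γ (e.1 + Pi.single e.2 1))⁻¹) (x + Pi.single ν 1, μ))⁻¹ *
        ((fun e : RectTorusSite Ls × Fin k => γ e.1 * b e * (γ (e.1 + Pi.single e.2 1))⁻¹) (x, ν))⁻¹ =
      γ x * (b (x, μ) * b (x + Pi.single μ 1, ν) * (b (x + Pi.single ν 1, μ))⁻¹ * (b (x, ν))⁻¹) * (γ x)⁻¹ := by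
  dsimp only
  have hc : x + Pi.single μ 1 + Pi.single ν 1 = x + Pi.single ν 1 + Pi.single μ 1 := by
    rw [add_assoc, add_assoc]
    congr 1
    exact add_comm _ _
  rw [hc]
  group

/-- The plaquette holonomy is blind to every central twist (the loop crosses each seam twice or not at all).
[cite: tHooft1979Flux] -/
theorem rectPlaquette_fluxTwist {z : G} (hz : z ∈ Subgroup.center G) (s : Fin k → ZMod 2) (b : RectSlice Ls G)
    (x : RectTorusSite Ls) {μ ν : Fin k} (hμν : μ ≠ ν) :
    rectFluxTwist z s b (x, μ) * rectFluxTwist z s b (x + Pi.single μ 1, ν) *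
        (rectFluxTwist z s b (x + Pi.single ν 1, μ))⁻¹ * (rectFluxTwist z s b (x, ν))⁻¹ =
      b (x, μ) * b (x + Pi.single μ 1, ν) * (b (x + Pi.single ν 1, μ))⁻¹ * (b (x, ν))⁻¹ := by
  have hc := rectFluxTwistPrefactor_mem_center (Ls := Ls) hz s
  simp only [rectFluxTwist_apply]
  rw [central_collect (hc _) (hc _) (hc _), rectFluxTwistPrefactor_shift z s x hμν.symm,
    rectFluxTwistPrefactor_shift z s x hμν, comm_eq_one_of_mem_center _ (hc _), one_mul]

omit [∀ i, NeZero (Ls i)] in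
/-- `1 ≠ 0` in `ZMod (Ls μ)` as soon as `Ls μ ≥ 2`. [folklore] -/
theorem zmod_one_ne_zero_of_two_le {μ : Fin k} (hμ : 2 ≤ Ls μ) : (1 : ZMod (Ls μ)) ≠ 0 := by
  intro h1
  have h2 : ((1 : ℕ) : ZMod (Ls μ)) = 0 := by exact_mod_cast h1
  rw [ZMod.natCast_eq_zero_iff] at h2
  have := Nat.le_of_dvd one_pos h2
  omega

omit [∀ i, NeZero (Ls i)] in
/-- `ê_μ ≠ 0` on the rectangular torus as soon as `Ls μ ≥ 2`. [folklore] -/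
theorem rectTorusSite_single_one_ne_zero {μ : Fin k} (hμ : 2 ≤ Ls μ) : (Pi.single μ 1 : RectTorusSite Ls) ≠ 0 := by
  intro h
  have := congr_fun h μ
  rw [Pi.single_eq_same, Pi.zero_apply] at this
  exact zmod_one_ne_zero_of_two_le (Ls := Ls) hμ this

omit [∀ i, NeZero (Ls i)] in
/-- The four links of a plaquette are distinct (`μ ≠ ν`, `Ls μ, Ls ν ≥ 2`). [folklore] -/
theorem rectPlaquetteLinks_injective {μ ν : Fin k} (hμν : μ ≠ ν) (hμ : 2 ≤ Ls μ) (hν : 2 ≤ Ls ν) (x : RectTorusSite Ls) :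
    Injective (![(x, μ), (x + Pi.single μ 1, ν), (x + Pi.single ν 1, μ), (x, ν)] : Fin 4 → RectTorusSite Ls × Fin k) := by
  have h1 := rectTorusSite_single_one_ne_zero (Ls := Ls) hμ
  have h2 := rectTorusSite_single_one_ne_zero (Ls := Ls) hν
  have h12 : (Pi.single μ 1 : RectTorusSite Ls) ≠ Pi.single ν 1 := by
    intro h
    have := congr_fun h μ
    rw [Pi.single_eq_same, Pi.single_eq_of_ne hμν] at this
    exact zmod_one_ne_zero_of_two_le (Ls := Ls) hμ this
  intro t t' h
  fin_cases t <;> fin_cases t' <;>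
    simp_all [Prod.ext_iff]

end Plaquette


end Summit.Ventures.YMGap.FlowData
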